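/-
Copyright (c) 2026 the pub-hodgecm-mathlib formalisation cell (harness21).  Prover seat hodgecm-mathlib-K2E3-p12 (g3), Track B «K2-LIT» ∕ h413
(`stmt-HodgeConjecture-24833`), line `K2_E3_EllipticInputs`, unit U12-d, §L: THE ASSEMBLY STEP OF (L-B_GL) AT `N = 2` — Harish-Chandra's regularity
theorem for `J(𝒩)(𝔤𝔩₂(F))` FOLLOWS from (a) the structure statement `J(𝒩) ⊆ ℂδ₀ + ℂμ_reg` and (b) the regularity of `μ̂_reg`, with `F_T = a + b·F_reg`.  2026-09-04.
-/
import Summits.HodgeConjecture.HodgeConjecture.Theorems.K2E3GLnNilpotentFourierPointSupport    -- ★ p856457 (this seat): `isLocSmooth_matrixFourier`, `matrixFourier_apply_zero`; ★ `continuous_discr_charpoly`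
import Summits.HodgeConjecture.HodgeConjecture.Theorems.K2E3GL2RegularNilpotentOrbitalMeasure   -- ★ p856734 (this seat): `μ_reg ∈ J(𝒩) ∖ ℂδ₀`
import HarnessLib

/-!
# K2_E3 road (h413), §L — (L-B_GL) at `N = 2` reduced to STRUCTURE + REGULARITY OF `μ̂_reg` (the assembly step, sorry-free)

Cell `pub/hodgecm-mathlib` (D-0151), Track B, seat K2E3-p12 (g3), §L line lead (dealer K2E3-plan (g2), D20).  `--supports stmt-HodgeConjecture-24833 --as helper`;
THEOREMS ONLY (no definition ∕ instance ∕ notation ∕ named fact ∕ `sorry`); never imports `Cruxes/…/Lines`.  COUNT-NEUTRAL: (L-B_GL) :310 stays OPEN (∀ N).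

The socket (L-B_GL) `sig_K2E3GLnNilpotentFourierRegular` (U12 ED. 7 :310) asks, for every `T ∈ J(𝒩)(𝔤𝔩_N(F))` (clauses (i) additivity, (ii) homogeneity,
(iii) `Ad(GL_N(F))`-invariance, (iv) support in the nilpotent cone), for a locally integrable `F_T` representing `T ∘ 𝓕`, locally constant on the regular
semisimple set, with `|disc χ|_F^{1/2}·|F_T|` locally bounded [HarishChandra1999AdmissibleDistributions, Thm. 4.4].  At `N = 2`, `J(𝒩) = ℂδ₀ ⊕ ℂμ_reg`
[ibid., Thm. 3.9, Cor. 3.10: `dim J(𝒩)` = number of nilpotent orbits = 2]; ★ p856457 pays `δ₀`, ★ p856734 exhibits `μ_reg(f) = ∫_{GL₂(𝒪)×F} f(k (tE₁₂) k⁻¹)`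
in `J(𝒩) ∖ ℂδ₀`.  This file is the ASSEMBLY: it proves the `N = 2` body of the socket for every `T` from the two remaining named debts, stated as hypotheses
in the socket's own currency —
* (a) STRUCTURE `hA`: every `T` with (i)–(iv) is `a·δ₀ + b·μ_reg` on `C_c^∞(𝔤𝔩₂(F))`;
* (b) REGULARITY OF `μ̂_reg` `hB`: some locally integrable `F_reg`, locally constant on `{disc χ ≠ 0}` with `|disc χ|^{1/2}·|F_reg|` locally bounded, represents
  `μ_reg ∘ 𝓕` [ibid., Thm. 4.4 for `μ_reg`; explicitly `F_reg(Y) = c·|disc χ_Y|^{-1/2}` for `Y` split regular, `0` for `Y` elliptic] —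
with the explicit answer `F_T = a + b·F_reg` (`fourierRegular_of_eq_delta_add_orbital`): `T(𝓕f) = a·𝓕f(0) + b·μ_reg(𝓕f) = a ∫f + b ∫ f·F_reg` (★ `matrixFourier_apply_zero`,
`𝓕f ∈ C_c^∞` by ★ `isLocSmooth_matrixFourier`), local constancy is inherited, and `|disc|^{1/2}` is bounded on compacta (★ `continuous_discr_charpoly`,
`exists_bound_sqrt_normAbs_discr`).  Packaged head: **`gl2_nilpotentFourierRegular_of_structure`** = `hA → hB → (L-B_GL)|_{N=2}` letter for letter.

References: [HarishChandra1999AdmissibleDistributions] Harish-Chandra, *Admissible invariant distributions on reductive p-adic groups* (notes by DeBacker–Sally), AMS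
ULECT 16 (1999), §3 pp. 8–10, Thm. 3.9, Cor. 3.10, Thm. 4.4 p. 11 · [Howe1974] R. Howe, *The Fourier transform and germs of characters*, Math. Ann. 208 (1974), Prop. 3.
-/

set_option autoImplicit false
set_option linter.dupNamespace false   -- `Summit.HodgeConjecture.HodgeConjecture.…` (D-0017 nested layout; lakefile exemption for Summits)

noncomputable section

open MeasureTheory Measure Filter Topology
open scoped MatrixGroups NNReal ENNReal
open Literature.NumberTheory.Rogawski1990 Literature.NumberTheory.Automorphic Literature.NumberTheory.Automorphic.LocalFieldHaar
open Literature.NumberTheory.GaloisRepresentations Literature.NumberTheory.GaloisRepresentations.IsNonarchimedeanLocalField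
open Summit.HodgeConjecture.HodgeConjecture.Cruxes.H413.K2E3GLnNilpotentFourierPointSupport
open Summit.HodgeConjecture.HodgeConjecture.Cruxes.H413.K2E3NormalizedCharBddNearSemisimpleRegular

namespace Summit.HodgeConjecture.HodgeConjecture.Cruxes.H413.K2E3GL2NilpotentFourierRegularOfStructure

variable {F : Type*} [Field F] [ValuativeRel F] [TopologicalSpace F] [IsNonarchimedeanLocalField F]

/-! ## §1  `|disc χ_X|_F^{1/2}` is bounded on compact sets -/

/-- `X ↦ |disc χ_X|_F^{1/2}` is continuous on `𝔤𝔩_N(F)` (★ `continuous_discr_charpoly`, ★ `continuous_normAbs`), hence bounded on every compact set.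
[cite: HarishChandra1999AdmissibleDistributions, §4 p. 11] -/
theorem exists_bound_sqrt_normAbs_discr {N : ℕ} {C : Set (Matrix (Fin N) (Fin N) F)} (hC : IsCompact C) :
    ∃ M : ℝ, 0 ≤ M ∧ ∀ X ∈ C, ((NNReal.sqrt (normAbs F X.charpoly.discr) : ℝ≥0) : ℝ) ≤ M := by
  have hcont : Continuous fun X : Matrix (Fin N) (Fin N) F => ((NNReal.sqrt (normAbs F X.charpoly.discr) : ℝ≥0) : ℝ) :=
    NNReal.continuous_coe.comp (NNReal.continuous_sqrt.comp (continuous_normAbs.comp continuous_discr_charpoly))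
  obtain ⟨M, hM⟩ := hC.exists_bound_of_continuousOn hcont.continuousOn
  refine ⟨max M 0, le_max_right _ _, fun X hX => ?_⟩
  have h := hM X hX
  rw [Real.norm_eq_abs, abs_of_nonneg (NNReal.coe_nonneg _)] at h
  exact h.trans (le_max_left _ _)

/-! ## §2  `T = a·δ₀ + b·μ_reg` and `μ̂_reg = F_reg` give `T̂ = a + b·F_reg` -/

section Assembly

variable (ψ : AddChar F Circle) [MeasurableSpace (Matrix (Fin 2) (Fin 2) F)] [BorelSpace (Matrix (Fin 2) (Fin 2) F)]
  (μ𝔤 : Measure (Matrix (Fin 2) (Fin 2) F)) [μ𝔤.IsAddHaarMeasure]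
  [MeasurableSpace F] [MeasurableSpace (GL (Fin 2) F)] (κ : Measure ↥(glInt 2 F)) (dx : Measure F)

/-- **Assembly for one `T`**: if `T f = a·f(0) + b·μ_reg(f)` on `C_c^∞(𝔤𝔩₂(F))` and `F_reg` is a locally integrable function representing `μ_reg ∘ 𝓕`, locally
constant on `{disc χ ≠ 0}` with `|disc χ|^{1/2}·|F_reg|` locally bounded, then `F_T := a + b·F_reg` has the four properties (L-B_GL) asks of `T`.
[cite: HarishChandra1999AdmissibleDistributions, Thm. 4.4 p. 11, Cor. 3.10 p. 10] -/
theorem fourierRegular_of_eq_delta_add_orbital (hψ : ψ.IsContinuousNontrivial) (T : (Matrix (Fin 2) (Fin 2) F → ℂ) → ℂ) (a b : ℂ)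
    (hab : ∀ f : Matrix (Fin 2) (Fin 2) F → ℂ, IsLocSmooth f →
      T f = a * f 0 + b * ∫ p : ↥(glInt 2 F) × F, f (((p.1 : GL (Fin 2) F) : Matrix (Fin 2) (Fin 2) F) * !![0, p.2; 0, 0] *
        ((((p.1 : GL (Fin 2) F))⁻¹ : GL (Fin 2) F) : Matrix (Fin 2) (Fin 2) F)) ∂(κ.prod dx))
    (Fr : Matrix (Fin 2) (Fin 2) F → ℂ) (hFr_int : LocallyIntegrable Fr μ𝔤)
    (hFr_rep : ∀ f : Matrix (Fin 2) (Fin 2) F → ℂ, IsLocSmooth f →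
      ∫ p : ↥(glInt 2 F) × F, (fun Y : Matrix (Fin 2) (Fin 2) F => ∫ X, ((ψ (Matrix.trace (Y * X)) : Circle) : ℂ) * f X ∂μ𝔤)
          (((p.1 : GL (Fin 2) F) : Matrix (Fin 2) (Fin 2) F) * !![0, p.2; 0, 0] * ((((p.1 : GL (Fin 2) F))⁻¹ : GL (Fin 2) F) : Matrix (Fin 2) (Fin 2) F)) ∂(κ.prod dx) =
        ∫ X, f X * Fr X ∂μ𝔤)
    (hFr_lc : ∀ X : Matrix (Fin 2) (Fin 2) F, IsUnit X.charpoly.discr → ∀ᶠ Y in 𝓝 X, Fr Y = Fr X)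
    (hFr_bd : ∀ C : Set (Matrix (Fin 2) (Fin 2) F), IsCompact C → ∃ B : ℝ, ∀ X ∈ C,
      ((NNReal.sqrt (normAbs F X.charpoly.discr) : ℝ≥0) : ℝ) * ‖Fr X‖ ≤ B) :
    LocallyIntegrable (fun X => a + b * Fr X) μ𝔤 ∧
      (∀ f : Matrix (Fin 2) (Fin 2) F → ℂ, IsLocSmooth f →
          T (fun Y => ∫ X, ((ψ (Matrix.trace (Y * X)) : Circle) : ℂ) * f X ∂μ𝔤) = ∫ X, f X * (a + b * Fr X) ∂μ𝔤) ∧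
      (∀ X : Matrix (Fin 2) (Fin 2) F, IsUnit X.charpoly.discr → ∀ᶠ Y in 𝓝 X, a + b * Fr Y = a + b * Fr X) ∧
      (∀ C : Set (Matrix (Fin 2) (Fin 2) F), IsCompact C → ∃ B : ℝ, ∀ X ∈ C,
          ((NNReal.sqrt (normAbs F X.charpoly.discr) : ℝ≥0) : ℝ) * ‖a + b * Fr X‖ ≤ B) := by
  haveI : T2Space F := (isLocalField F).toT2Space
  haveI : LocallyCompactSpace F := (isLocalField F).toLocallyCompactSpace
  haveI : LocallyCompactSpace (Matrix (Fin 2) (Fin 2) F) := Pi.locallyCompactSpace_of_finite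
  refine ⟨?_, ?_, ?_, ?_⟩
  · -- local integrability of `a + b·F_reg`
    have h1 : LocallyIntegrable (fun _ : Matrix (Fin 2) (Fin 2) F => a) μ𝔤 := locallyIntegrable_const a
    have h2 : LocallyIntegrable (fun X : Matrix (Fin 2) (Fin 2) F => b * Fr X) μ𝔤 := by
      have := hFr_int.smul b
      simpa only [Pi.smul_def, smul_eq_mul] using this
    exact h1.add h2
  · -- the representation `T(𝓕f) = ∫ f·(a + b F_reg)`
    intro f hf
    have hFf : IsLocSmooth fun Y : Matrix (Fin 2) (Fin 2) F => ∫ X, ((ψ (Matrix.trace (Y * X)) : Circle) : ℂ) * f X ∂μ𝔤 :=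
      isLocSmooth_matrixFourier hψ μ𝔤 hf
    rw [hab _ hFf, matrixFourier_apply_zero ψ μ𝔤 f, hFr_rep f hf]
    have hfi : Integrable f μ𝔤 := hf.continuous.integrable_of_hasCompactSupport hf.2
    have hfFr : Integrable (fun X => f X * Fr X) μ𝔤 := by
      have := hFr_int.integrable_smul_left_of_hasCompactSupport hf.continuous hf.2
      simpa only [smul_eq_mul] using this
    have hsplit : (fun X => f X * (a + b * Fr X)) = fun X => a * f X + b * (f X * Fr X) := by
      funext X; ring
    rw [hsplit, integral_add (hfi.const_mul a) (hfFr.const_mul b), integral_const_mul, integral_const_mul]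
  · -- local constancy on the regular semisimple set
    intro X hX
    exact (hFr_lc X hX).mono fun Y hY => by rw [hY]
  · -- `|disc|^{1/2}·|a + b F_reg|` is locally bounded
    intro C hC
    obtain ⟨M, -, hM⟩ := exists_bound_sqrt_normAbs_discr (F := F) hC
    obtain ⟨B, hB⟩ := hFr_bd C hC
    refine ⟨M * ‖a‖ + ‖b‖ * B, fun X hX => ?_⟩
    have hD0 : 0 ≤ ((NNReal.sqrt (normAbs F X.charpoly.discr) : ℝ≥0) : ℝ) := NNReal.coe_nonneg _
    calc ((NNReal.sqrt (normAbs F X.charpoly.discr) : ℝ≥0) : ℝ) * ‖a + b * Fr X‖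
        ≤ ((NNReal.sqrt (normAbs F X.charpoly.discr) : ℝ≥0) : ℝ) * (‖a‖ + ‖b‖ * ‖Fr X‖) :=
          mul_le_mul_of_nonneg_left ((norm_add_le _ _).trans (by rw [norm_mul])) hD0
      _ = ((NNReal.sqrt (normAbs F X.charpoly.discr) : ℝ≥0) : ℝ) * ‖a‖ +
            ‖b‖ * (((NNReal.sqrt (normAbs F X.charpoly.discr) : ℝ≥0) : ℝ) * ‖Fr X‖) := by ring
      _ ≤ M * ‖a‖ + ‖b‖ * B :=
          add_le_add (mul_le_mul_of_nonneg_right (hM X hX) (norm_nonneg _)) (mul_le_mul_of_nonneg_left (hB X hX) (norm_nonneg _))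

/-- **(L-B_GL) at `N = 2` from STRUCTURE + REGULARITY OF `μ̂_reg`** (the assembly step, sorry-free): if (a) every `T ∈ J(𝒩)(𝔤𝔩₂(F))` (clauses (i)–(iv) of the
socket) is `a·δ₀ + b·μ_reg` on `C_c^∞(𝔤𝔩₂(F))`, and (b) `μ_reg ∘ 𝓕` is represented by a locally integrable `F_reg`, locally constant on `{disc χ ≠ 0}` with
`|disc χ|^{1/2}·|F_reg|` locally bounded, then the body of `sig_K2E3GLnNilpotentFourierRegular` holds at `N = 2` for every `T`, with `F_T = a + b·F_reg`.
[cite: HarishChandra1999AdmissibleDistributions, Thm. 3.9, Cor. 3.10 p. 10, Thm. 4.4 p. 11] -/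
theorem gl2_nilpotentFourierRegular_of_structure (hψ : ψ.IsContinuousNontrivial)
    (hA : ∀ T : (Matrix (Fin 2) (Fin 2) F → ℂ) → ℂ,
      ((∀ f₁ f₂ : Matrix (Fin 2) (Fin 2) F → ℂ, IsLocSmooth f₁ → IsLocSmooth f₂ → T (f₁ + f₂) = T f₁ + T f₂) ∧
       (∀ (a : ℂ) (f : Matrix (Fin 2) (Fin 2) F → ℂ), IsLocSmooth f → T (a • f) = a * T f) ∧
       (∀ (x : GL (Fin 2) F) (f : Matrix (Fin 2) (Fin 2) F → ℂ), IsLocSmooth f →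
          T (fun X => f ((x : Matrix (Fin 2) (Fin 2) F) * X * ((x⁻¹ : GL (Fin 2) F) : Matrix (Fin 2) (Fin 2) F))) = T f) ∧
       (∀ f : Matrix (Fin 2) (Fin 2) F → ℂ, IsLocSmooth f → (∀ X ∈ tsupport f, ¬ IsNilpotent X) → T f = 0)) →
      ∃ a b : ℂ, ∀ f : Matrix (Fin 2) (Fin 2) F → ℂ, IsLocSmooth f →
        T f = a * f 0 + b * ∫ p : ↥(glInt 2 F) × F, f (((p.1 : GL (Fin 2) F) : Matrix (Fin 2) (Fin 2) F) * !![0, p.2; 0, 0] *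
          ((((p.1 : GL (Fin 2) F))⁻¹ : GL (Fin 2) F) : Matrix (Fin 2) (Fin 2) F)) ∂(κ.prod dx))
    (hB : ∃ Fr : Matrix (Fin 2) (Fin 2) F → ℂ, LocallyIntegrable Fr μ𝔤 ∧
      (∀ f : Matrix (Fin 2) (Fin 2) F → ℂ, IsLocSmooth f →
        ∫ p : ↥(glInt 2 F) × F, (fun Y : Matrix (Fin 2) (Fin 2) F => ∫ X, ((ψ (Matrix.trace (Y * X)) : Circle) : ℂ) * f X ∂μ𝔤)
            (((p.1 : GL (Fin 2) F) : Matrix (Fin 2) (Fin 2) F) * !![0, p.2; 0, 0] * ((((p.1 : GL (Fin 2) F))⁻¹ : GL (Fin 2) F) : Matrix (Fin 2) (Fin 2) F)) ∂(κ.prod dx) =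
          ∫ X, f X * Fr X ∂μ𝔤) ∧
      (∀ X : Matrix (Fin 2) (Fin 2) F, IsUnit X.charpoly.discr → ∀ᶠ Y in 𝓝 X, Fr Y = Fr X) ∧
      (∀ C : Set (Matrix (Fin 2) (Fin 2) F), IsCompact C → ∃ B : ℝ, ∀ X ∈ C,
          ((NNReal.sqrt (normAbs F X.charpoly.discr) : ℝ≥0) : ℝ) * ‖Fr X‖ ≤ B))
    (T : (Matrix (Fin 2) (Fin 2) F → ℂ) → ℂ)
    (hT : (∀ f₁ f₂ : Matrix (Fin 2) (Fin 2) F → ℂ, IsLocSmooth f₁ → IsLocSmooth f₂ → T (f₁ + f₂) = T f₁ + T f₂) ∧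
       (∀ (a : ℂ) (f : Matrix (Fin 2) (Fin 2) F → ℂ), IsLocSmooth f → T (a • f) = a * T f) ∧
       (∀ (x : GL (Fin 2) F) (f : Matrix (Fin 2) (Fin 2) F → ℂ), IsLocSmooth f →
          T (fun X => f ((x : Matrix (Fin 2) (Fin 2) F) * X * ((x⁻¹ : GL (Fin 2) F) : Matrix (Fin 2) (Fin 2) F))) = T f) ∧
       (∀ f : Matrix (Fin 2) (Fin 2) F → ℂ, IsLocSmooth f → (∀ X ∈ tsupport f, ¬ IsNilpotent X) → T f = 0)) :
    ∃ Fn : Matrix (Fin 2) (Fin 2) F → ℂ, LocallyIntegrable Fn μ𝔤 ∧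
      (∀ f : Matrix (Fin 2) (Fin 2) F → ℂ, IsLocSmooth f →
          T (fun Y => ∫ X, ((ψ (Matrix.trace (Y * X)) : Circle) : ℂ) * f X ∂μ𝔤) = ∫ X, f X * Fn X ∂μ𝔤) ∧
      (∀ X : Matrix (Fin 2) (Fin 2) F, IsUnit X.charpoly.discr → ∀ᶠ Y in 𝓝 X, Fn Y = Fn X) ∧
      (∀ C : Set (Matrix (Fin 2) (Fin 2) F), IsCompact C → ∃ B : ℝ, ∀ X ∈ C,
          ((NNReal.sqrt (normAbs F X.charpoly.discr) : ℝ≥0) : ℝ) * ‖Fn X‖ ≤ B) := by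
  obtain ⟨a, b, hab⟩ := hA T hT
  obtain ⟨Fr, hFr_int, hFr_rep, hFr_lc, hFr_bd⟩ := hB
  exact ⟨fun X => a + b * Fr X, fourierRegular_of_eq_delta_add_orbital ψ μ𝔤 κ dx hψ T a b hab Fr hFr_int hFr_rep hFr_lc hFr_bd⟩

end Assembly

end Summit.HodgeConjecture.HodgeConjecture.Cruxes.H413.K2E3GL2NilpotentFourierRegularOfStructure
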